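import Literature.AnabelianGeometry.AbsoluteAnabelian.AbsTopIProp23GFGSurfaceModelExtension
import Literature.AnabelianGeometry.AbsoluteAnabelian.AbsTopIProp23GFGAffineModelExtension
import Literature.AnabelianGeometry.AbsoluteAnabelian.AbsTopIProp23iHyperbolicModelProofs
import HarnessLib

/-!
# [AbsTopI] Prop 2.2 / Prop 2.3 (i) / Prop 2.3 (ii) at the Def 2.1 (i) GFG construction — ONE statement for every hyperbolic type `(g, r)`

S. Mochizuki, *Topics in Absolute Anabelian Geometry I: Generalities* (2012) [AbsTopI] (lit key
`paper:url-11ac98ba15fc`), Def 2.1 (i)(ii) p. 17, Prop 2.2 p. 18, Prop 2.3 (i)(ii) p. 19.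

PROOF-ONLY packaging (abc-iut cell, seat abc-iut-w6-d030 g4; no definition, no named fact, nothing restated).
The tree proves the three typed node predicates `E.GeomTFG` (Prop 2.2), `E.GeomSlimElastic` (Prop 2.3 (i)) and
`E.ArithSlimNotElastic` (Prop 2.3 (ii): «`Π` is slim, but not elastic») for an extension `1 → Δ → Π → G → 1`
with MLF resp. NF base data whose `Δ` IS the Def 2.1 (i) quotient of a pro-`Σ′` completion of the topological
fundamental group `Γ` of a hyperbolic curve of type `(g, r)` — in TWO shapes: the PROPER shape
`prop22_prop23_gfg_mlf/_nf` (`Γ ≃* S_g`, `g ≥ 2`; `AbsTopIProp23GFGSurfaceModelExtension.lean`, p440871) and the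
AFFINE shape `prop22_prop23_gfg_puncturedSurfaceGroup_mlf/_nf` (`Γ = Γ_{g,k+1}`;
`AbsTopIProp23GFGAffineModelExtension.lean`, p443488).  This file states the conjunction ONCE, uniformly in the
type `(g, r)` with `2g − 2 + r > 0` (`PuncturedSurfaceGroup.IsHyperbolicType g r`), over the presentation
`j : Γ_{g,r} → P` (pro-`Σ′` completion) — `prop22_prop23_gfg_hyperbolic_mlf/_nf` (case `r = 0` transported along
`Γ_{g,0} ≅ S_g`, `nonempty_mulEquiv_puncturedSurfaceGroup_zero`, `g ≥ 2` by `two_le_genus_of_isHyperbolicType_zero` of p431701; case `r = k + 1` verbatim) — and records the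
Prop 2.3 (ii) projection `arithSlimNotElastic_gfg_hyperbolic_mlf/_nf` under its own name (the node predicate of
AbsTopI:Prop2.3(ii), so far only available as the third conjunct of the Prop 2.2/2.3 packages).

HYPOTHESES = the Def 2.1 (i) construction data only (`Σ ⊆ Σ′`, `Σ ∋` a prime, all of `Σ` prime, `P` a
compact totally disconnected pro-`Σ′` completion of `Γ_{g,r}`, `U ⊴ P` open, `π : P ↠ Δ` continuous with
`ker π ≤ U` and `π|_U` presenting the maximal pro-`Σ` quotient) + the base data `B`; (FN) «no nontrivial finite
normal subgroup» is a THEOREM at the construction (p440186 / p443001), not a hypothesis.  HONEST SCOPE: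
model-level (curves, Riemann-existence presentation of `π₁`; orbicurves not covered here); classical; OUR kernel
check of OUR typed statements; nothing here bears on [IUTchIII] Cor. 3.12; typed ≠ proved elsewhere.
-/

noncomputable section

open Topology

namespace Literature.AnabelianGeometry.AbsoluteAnabelian

namespace FundamentalExtension

open Literature.AnabelianGeometry.SemiGraphs.PSCDatum (IsMaxProSigmaQuotient)
open Literature.AnabelianGeometry.SemiGraphs.SemiGraphOfAnabelioids
open Literature.AnabelianGeometry.SemiGraphs.SemiGraphOfAnabelioids.IsProSigmaCompletion
open Literature.GroupTheory.CombinatorialGroupTheory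
open Literature.Topology.FourManifolds (SurfaceGroup)

variable {E : FundamentalExtension.{0}} {Sigma Sigma' : Set ℕ} {g r : ℕ}
  {P : Type} [Group P] [TopologicalSpace P] [IsTopologicalGroup P] [CompactSpace P]
  [TotallyDisconnectedSpace P] {j : PuncturedSurfaceGroup g r →* P} {π : P →* E.geom} {U : Subgroup P}

/-- **[AbsTopI] Prop 2.2 + Prop 2.3 (i) + Prop 2.3 (ii) at the Def 2.1 (i) GFG construction, EVERY hyperbolic
type `(g, r)`, MLF base**: for an extension `1 → Δ → Π → G → 1` with MLF base data whose `Δ = E.geom` is the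
Def 2.1 (i) quotient of a pro-`Σ′` completion `P` of `Γ_{g,r}` (`2g − 2 + r > 0`), `Δ` is topologically finitely
generated, slim and elastic, and `Π` is slim but not elastic.  Case `r = 0`: `prop22_prop23_gfg_mlf` along
`Γ_{g,0} ≅ S_g`; case `r = k + 1`: `prop22_prop23_gfg_puncturedSurfaceGroup_mlf`.
[cite: MochizukiAbsTopI2012, Prop 2.3 p.19] -/
theorem prop22_prop23_gfg_hyperbolic_mlf (B : E.MLFBase) (hgr : PuncturedSurfaceGroup.IsHyperbolicType g r)
    (hSS : Sigma ⊆ Sigma') (hS : ∃ ℓ ∈ Sigma, ℓ.Prime) (hSp : ∀ p ∈ Sigma, p.Prime)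
    (hj : IsProSigmaCompletion Sigma' j) [U.Normal] (hUo : IsOpen (U : Set P)) (hπc : Continuous π)
    (hπs : Function.Surjective π) (hker : π.ker ≤ U) (hmax : IsMaxProSigmaQuotient Sigma (π.subgroupMap U)) :
    E.GeomTFG ∧ E.GeomSlimElastic ∧ E.ArithSlimNotElastic := by
  cases r with
  | zero =>
    obtain ⟨e⟩ := nonempty_mulEquiv_puncturedSurfaceGroup_zero g
    exact prop22_prop23_gfg_mlf B hSS hS hSp (two_le_genus_of_isHyperbolicType_zero hgr) e hj hUo hπc hπs
      hker hmax
  | succ k => exact prop22_prop23_gfg_puncturedSurfaceGroup_mlf B hgr hSS hS hSp hj hUo hπc hπs hker hmax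

/-- **The same, NF base.** [cite: MochizukiAbsTopI2012, Prop 2.3 p.19] -/
theorem prop22_prop23_gfg_hyperbolic_nf (B : E.NFBase) (hgr : PuncturedSurfaceGroup.IsHyperbolicType g r)
    (hSS : Sigma ⊆ Sigma') (hS : ∃ ℓ ∈ Sigma, ℓ.Prime) (hSp : ∀ p ∈ Sigma, p.Prime)
    (hj : IsProSigmaCompletion Sigma' j) [U.Normal] (hUo : IsOpen (U : Set P)) (hπc : Continuous π)
    (hπs : Function.Surjective π) (hker : π.ker ≤ U) (hmax : IsMaxProSigmaQuotient Sigma (π.subgroupMap U)) :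
    E.GeomTFG ∧ E.GeomSlimElastic ∧ E.ArithSlimNotElastic := by
  cases r with
  | zero =>
    obtain ⟨e⟩ := nonempty_mulEquiv_puncturedSurfaceGroup_zero g
    exact prop22_prop23_gfg_nf B hSS hS hSp (two_le_genus_of_isHyperbolicType_zero hgr) e hj hUo hπc hπs
      hker hmax
  | succ k => exact prop22_prop23_gfg_puncturedSurfaceGroup_nf B hgr hSS hS hSp hj hUo hπc hπs hker hmax

/-- **[AbsTopI] Prop 2.3 (i) `E.GeomSlimElastic` at the Def 2.1 (i) GFG construction, every hyperbolic `(g, r)`**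
(any base `G`): `Δ` is slim and elastic — `geomSlimElastic_gfg` (`r = 0`, along `Γ_{g,0} ≅ S_g`) /
`geomSlimElastic_gfg_puncturedSurfaceGroup` (`r = k + 1`). [cite: MochizukiAbsTopI2012, Prop 2.3 (i) p.19] -/
theorem geomSlimElastic_gfg_hyperbolic (hgr : PuncturedSurfaceGroup.IsHyperbolicType g r)
    (hSS : Sigma ⊆ Sigma') (hS : ∃ ℓ ∈ Sigma, ℓ.Prime) (hj : IsProSigmaCompletion Sigma' j) [U.Normal]
    (hUo : IsOpen (U : Set P)) (hπc : Continuous π) (hπs : Function.Surjective π) (hker : π.ker ≤ U)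
    (hmax : IsMaxProSigmaQuotient Sigma (π.subgroupMap U)) : E.GeomSlimElastic := by
  cases r with
  | zero =>
    obtain ⟨e⟩ := nonempty_mulEquiv_puncturedSurfaceGroup_zero g
    exact geomSlimElastic_gfg hSS hS (two_le_genus_of_isHyperbolicType_zero hgr) e hj hUo hπc hπs hker hmax
  | succ k => exact geomSlimElastic_gfg_puncturedSurfaceGroup hgr hSS hS hj hUo hπc hπs hker hmax

/-- **[AbsTopI] Prop 2.3 (ii) at the Def 2.1 (i) GFG construction, every hyperbolic `(g, r)`, MLF base**: the
typed node predicate `E.ArithSlimNotElastic` («`Π` is slim, but not elastic») holds — third conjunct of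
`prop22_prop23_gfg_hyperbolic_mlf`, recorded under its own name for the node AbsTopI:Prop2.3(ii).
[cite: MochizukiAbsTopI2012, Prop 2.3 (ii) p.19] -/
theorem arithSlimNotElastic_gfg_hyperbolic_mlf (B : E.MLFBase) (hgr : PuncturedSurfaceGroup.IsHyperbolicType g r)
    (hSS : Sigma ⊆ Sigma') (hS : ∃ ℓ ∈ Sigma, ℓ.Prime) (hSp : ∀ p ∈ Sigma, p.Prime)
    (hj : IsProSigmaCompletion Sigma' j) [U.Normal] (hUo : IsOpen (U : Set P)) (hπc : Continuous π)
    (hπs : Function.Surjective π) (hker : π.ker ≤ U) (hmax : IsMaxProSigmaQuotient Sigma (π.subgroupMap U)) :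
    Literature.AnabelianGeometry.AbsoluteAnabelian.FundamentalExtension.ArithSlimNotElastic E :=
  (prop22_prop23_gfg_hyperbolic_mlf B hgr hSS hS hSp hj hUo hπc hπs hker hmax).2.2

/-- **[AbsTopI] Prop 2.3 (ii) at the Def 2.1 (i) GFG construction, every hyperbolic `(g, r)`, NF base.**
[cite: MochizukiAbsTopI2012, Prop 2.3 (ii) p.19] -/
theorem arithSlimNotElastic_gfg_hyperbolic_nf (B : E.NFBase) (hgr : PuncturedSurfaceGroup.IsHyperbolicType g r)
    (hSS : Sigma ⊆ Sigma') (hS : ∃ ℓ ∈ Sigma, ℓ.Prime) (hSp : ∀ p ∈ Sigma, p.Prime)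
    (hj : IsProSigmaCompletion Sigma' j) [U.Normal] (hUo : IsOpen (U : Set P)) (hπc : Continuous π)
    (hπs : Function.Surjective π) (hker : π.ker ≤ U) (hmax : IsMaxProSigmaQuotient Sigma (π.subgroupMap U)) :
    Literature.AnabelianGeometry.AbsoluteAnabelian.FundamentalExtension.ArithSlimNotElastic E :=
  (prop22_prop23_gfg_hyperbolic_nf B hgr hSS hS hSp hj hUo hπc hπs hker hmax).2.2

/-- **[AbsTopI] Prop 2.2 `E.GeomTFG` at the Def 2.1 (i) GFG construction, every hyperbolic `(g, r)`** (the
conclusion does not mention the base; obtained here through the MLF package, and through the NF package in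
`geomTFG_gfg_hyperbolic_nf`). [cite: MochizukiAbsTopI2012, Prop 2.2 p.18] -/
theorem geomTFG_gfg_hyperbolic_mlf (B : E.MLFBase) (hgr : PuncturedSurfaceGroup.IsHyperbolicType g r)
    (hSS : Sigma ⊆ Sigma') (hS : ∃ ℓ ∈ Sigma, ℓ.Prime) (hSp : ∀ p ∈ Sigma, p.Prime)
    (hj : IsProSigmaCompletion Sigma' j) [U.Normal] (hUo : IsOpen (U : Set P)) (hπc : Continuous π)
    (hπs : Function.Surjective π) (hker : π.ker ≤ U) (hmax : IsMaxProSigmaQuotient Sigma (π.subgroupMap U)) :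
    E.GeomTFG :=
  (prop22_prop23_gfg_hyperbolic_mlf B hgr hSS hS hSp hj hUo hπc hπs hker hmax).1

/-- **[AbsTopI] Prop 2.2 `E.GeomTFG` at the GFG construction, every hyperbolic `(g, r)`, NF package.**
[cite: MochizukiAbsTopI2012, Prop 2.2 p.18] -/
theorem geomTFG_gfg_hyperbolic_nf (B : E.NFBase) (hgr : PuncturedSurfaceGroup.IsHyperbolicType g r)
    (hSS : Sigma ⊆ Sigma') (hS : ∃ ℓ ∈ Sigma, ℓ.Prime) (hSp : ∀ p ∈ Sigma, p.Prime)
    (hj : IsProSigmaCompletion Sigma' j) [U.Normal] (hUo : IsOpen (U : Set P)) (hπc : Continuous π)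
    (hπs : Function.Surjective π) (hker : π.ker ≤ U) (hmax : IsMaxProSigmaQuotient Sigma (π.subgroupMap U)) :
    E.GeomTFG :=
  (prop22_prop23_gfg_hyperbolic_nf B hgr hSS hS hSp hj hUo hπc hπs hker hmax).1

end FundamentalExtension

/-! ### Non-vacuity at honest data, every hyperbolic type `(g, r)` -/

namespace GFGSurfaceModel

open Literature.AlgebraicGeometry.Frobenioids (IsSlimGroup)
open Literature.AnabelianGeometry.SemiGraphs.PSCDatum (IsMaxProSigmaQuotient)
open Literature.AnabelianGeometry.SemiGraphs.SemiGraphOfAnabelioids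
open Literature.GroupTheory.CombinatorialGroupTheory
open Literature.Topology.FourManifolds (SurfaceGroup)

universe u

variable {Sigma Sigma' : Set ℕ} {g r : ℕ} {P : Type u} [Group P] [TopologicalSpace P] [IsTopologicalGroup P]
  [CompactSpace P] [TotallyDisconnectedSpace P] [T2Space P]

/-- **Non-vacuity at honest data, every hyperbolic `(g, r)`**: for `P` ANY pro-`Σ′` completion of `Γ_{g,r}`
(`2g − 2 + r > 0`) and `U ⊴ P` ANY open normal subgroup (`Σ ⊆ Σ′`, `Σ` containing a prime), the Def 2.1 (i)
quotient `Δ_X := P ⧸ K_Σ(U)` EXISTS and is slim, elastic and without nontrivial finite normal subgroups — the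
proper case `exists_slim_and_elastic_gfgQuotient` (p441593, along `Γ_{g,0} ≅ S_g`) and the affine case
`GFGAffineModel.exists_slim_and_elastic_gfgQuotient` (p443488) in one statement.
[cite: MochizukiAbsTopI2012, Def 2.1 (i) p.17] -/
theorem exists_slim_and_elastic_gfgQuotient_hyperbolic (hgr : PuncturedSurfaceGroup.IsHyperbolicType g r)
    (hSS : Sigma ⊆ Sigma') (hS : ∃ ℓ ∈ Sigma, ℓ.Prime) {j : PuncturedSurfaceGroup g r →* P}
    (hj : IsProSigmaCompletion Sigma' j) (U : Subgroup P) [U.Normal] (hUo : IsOpen (U : Set P)) :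
    ∃ (K : Subgroup P) (_ : K.Normal) (_ : IsClosed (K : Set P)), K ≤ U ∧
      IsMaxProSigmaQuotient Sigma ((QuotientGroup.mk' K).subgroupMap U) ∧
      IsSlimGroup (P ⧸ K) ∧ IsElastic (P ⧸ K) ∧
      ∀ N : Subgroup (P ⧸ K), N.Normal → (N : Set (P ⧸ K)).Finite → N = ⊥ := by
  cases r with
  | zero =>
    obtain ⟨e⟩ := IsProSigmaCompletion.nonempty_mulEquiv_puncturedSurfaceGroup_zero g
    exact exists_slim_and_elastic_gfgQuotient hSS hS
      (FundamentalExtension.two_le_genus_of_isHyperbolicType_zero hgr) e hj U hUo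
  | succ k =>
    obtain ⟨hF, hfin, hn⟩ := GFGAffineModel.exists_isFreeGroup_puncturedSurfaceGroup hgr
    haveI := hF; haveI := hfin
    exact GFGAffineModel.exists_slim_and_elastic_gfgQuotient hSS hS hn hj U hUo

/-- **A fully explicit inhabitant for every hyperbolic `(g, r)`**: `P` a pro-`Σ′` completion of `Γ_{g,r}`
(`IsProSigmaCompletion.exists_isProSigmaCompletion`), `U = P`; the Def 2.1 (i) quotient exists and is slim,
elastic and FN-free — so the theorems of this file are not vacuous at any hyperbolic type.
[cite: MochizukiAbsTopI2012, Def 2.1 (i) p.17] -/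
theorem exists_model_hyperbolic (g r : ℕ) (hgr : PuncturedSurfaceGroup.IsHyperbolicType g r)
    (Sigma Sigma' : Set ℕ) (hSS : Sigma ⊆ Sigma') (hS : ∃ ℓ ∈ Sigma, ℓ.Prime) :
    ∃ (Q : ProfiniteGrp.{0}) (j : PuncturedSurfaceGroup g r →* Q) (U : Subgroup Q) (_ : U.Normal)
      (K : Subgroup Q) (_ : K.Normal), IsProSigmaCompletion Sigma' j ∧ IsOpen (U : Set Q) ∧
      IsClosed (K : Set Q) ∧ K ≤ U ∧ IsMaxProSigmaQuotient Sigma ((QuotientGroup.mk' K).subgroupMap U) ∧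
      IsSlimGroup (Q ⧸ K) ∧ IsElastic (Q ⧸ K) ∧
      ∀ N : Subgroup (Q ⧸ K), N.Normal → (N : Set (Q ⧸ K)).Finite → N = ⊥ := by
  obtain ⟨Q, j, hj⟩ := IsProSigmaCompletion.exists_isProSigmaCompletion (PuncturedSurfaceGroup g r) Sigma'
  obtain ⟨K, hKn, hKc, hKU, hmax, hs, he, hfn⟩ :=
    exists_slim_and_elastic_gfgQuotient_hyperbolic hgr hSS hS hj (⊤ : Subgroup Q) isOpen_univ
  exact ⟨Q, j, ⊤, inferInstance, K, hKn, hj, isOpen_univ, hKc, hKU, hmax, hs, he, hfn⟩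

end GFGSurfaceModel

end Literature.AnabelianGeometry.AbsoluteAnabelian

end
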